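import Summits.KontsevichZagierPeriods.KontsevichZagierPeriods.Theses.RootDecompRationalCubeDichotomy
import Summits.KontsevichZagierPeriods.KontsevichZagierPeriods.Theorems.SoloInformedPiDisc
import Summits.KontsevichZagierPeriods.KontsevichZagierPeriods.Theorems.RootDecompRationalCubeDichotomyPiTimesSector
import Literature.NumberTheory.Transcendental.KZProductIdeal
import Literature.NumberTheory.Transcendental.KZLogCalculusProofs
import Literature.NumberTheory.Transcendental.KZSemialgebraicComplex
import Literature.NumberTheory.Transcendental.KZCubicalCalculus
import Literature.NumberTheory.Transcendental.KZSemiCanonicalReductionProofs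
import Mathlib
import Literature.NumberTheory.Transcendental.KZGreenBandMove
import Summits.KontsevichZagierPeriods.KontsevichZagierPeriods.Theorems.RootDecompRationalCubeDichotomyPiRationalisationSqrtMoves
import Summits.KontsevichZagierPeriods.KontsevichZagierPeriods.Theorems.RootDecompRationalCubeDichotomyPiRationalisationSqrtDefs
import Summits.KontsevichZagierPeriods.KontsevichZagierPeriods.Theorems.RootDecompRationalCubeDichotomyPiRationalisationSqrt

/-!
# Route RootDecompRationalCubeDichotomy — item 27842 `PiRationalisationSimpleBranch` PROVED, part 1/11 (`RootDecompRationalCubeDichotomySimpleBranchWinding`)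

Theorems-split (≤ 400 lines each, sequential imports) of the decomp-kz lens-2 gen-4 file
`run/shared/lean/pub/decomp-kz/decomp-kz-lens-2/g4/PiRationalisationSimpleBranch27842.lean` (2963 lines; lens farm rc 0, writer re-check
rc 0 audit proof-of-item closed:true, critic g2 by-name probe std axioms, 2026-08-30T05:27:57Z/06:02:52Z). The rung: for simple-branch
Nash data (`F(x,g) = 0`, `∂_z F(x,g) ≠ 0` on the closed cube) `[π]^K·[s] ∈ relations ⊔ ⟨rational closed-cube sector⟩` for all `K ≥ 1` —
root isolation on rational sub-boxes, the Green band move (planar Stokes inside the four moves), the half winding number ≡ 4[A] ≡ [π],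
box rescaling, and `PiTimesSector` (item 26388, landed). The final part closes the ROUTE ITEM by name
(`piRationalisationSimpleBranch_proof`). Sector lemmas are REUSED from the landed rung-24903 file `…PiRationalisationSqrtMoves`.
[Kontsevich–Zagier 2001 §1.2; argument principle] Standard axioms, 0 sorry.
-/

noncomputable section

set_option linter.dupNamespace false

namespace Summit.KontsevichZagierPeriods.RootDecompRationalCubeDichotomy.Rung27842

open Summit.KontsevichZagierPeriods.RootDecompRationalCubeDichotomy.Rung24903 (unitI_eq_cubeLit)
open Summit.KontsevichZagierPeriods.RootDecompRationalCubeDichotomy.Rung24903 (of_sub_of_mem_relations_of_fibreMap)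
open MeasureTheory Set MvPolynomial
open Literature.NumberTheory.Transcendental
open Literature.NumberTheory.Transcendental.KZ
open Literature.ModelTheory.ExponentialFields (IsSemialgebraic)

/-! ### The half winding number -/

/-- A representation with a continuous `ℚ`-semialgebraic integrand on a compact `ℚ`-semialgebraic domain. -/
def contRep {k : ℕ} (D : Set (Fin k → ℝ)) (hD : IsSemialgebraic ℚ D) (hDc : IsCompact D)
    (f : (Fin k → ℝ) → ℝ) (hf : IsSemialgebraicFunOn ℚ D f) (hfc : ContinuousOn f D) : IntegralRep k :=
  ⟨D, f, hD, hf, hfc.integrableOn_compact hDc⟩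

/-- **The half-turn substitution.** `u = ε (t² + 2t − 1)/(1 + 2t − t²)` maps `[0,1]` increasingly onto `[−ε, ε]`
(`du/dt = 4ε(1+t²)/(1+2t−t²)²`, and `(t²+2t−1)² + (1+2t−t²)² = 2(1+t²)²`) and carries `2 dt/(1+t²)` to
`ε du/(u² + ε²)`: one change-of-variables move (`m = 0` of `of_sub_of_mem_relations_of_fibreMap`).
[Kontsevich–Zagier 2001, §1.2, rule 2)] -/
theorem of_sub_of_mem_relations_halfTurn (ε : ℚ) (hε : 0 < ε) (A2 T : IntegralRep 1)
    (h2d : A2.domain = {x | 0 ≤ x 0 ∧ x 0 ≤ 1}) (h2i : A2.integrand = fun x => 2 / (1 + x 0 ^ 2))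
    (hTd : T.domain = {u | -(ε:ℝ) ≤ u 0 ∧ u 0 ≤ (ε:ℝ)})
    (hTi : T.integrand = fun u => (ε:ℝ) / (u 0 ^ 2 + (ε:ℝ) ^ 2)) :
    of A2 - of T ∈ relations := by
  have hε' : (0:ℝ) < ε := by exact_mod_cast hε
  have hD : ∀ t : ℝ, 0 ≤ t → t ≤ 1 → 0 < 1 + 2 * t - t ^ 2 := fun t h0 h1 => by nlinarith
  have hmem : ∀ {z : Fin 1 → ℝ}, z ∈ A2.domain → 0 ≤ z 0 ∧ z 0 ≤ 1 := fun hz => by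
    rw [h2d] at hz; exact hz
  refine of_sub_of_mem_relations_of_fibreMap (m := 0) (G := univ) (a := fun _ => 0) (b := fun _ => 1)
    (a' := fun _ => -(ε:ℝ)) (b' := fun _ => (ε:ℝ))
    (fun z => (ε:ℝ) * (z 0 ^ 2 + 2 * z 0 - 1) / (1 + 2 * z 0 - z 0 ^ 2))
    (fun z => 4 * (ε:ℝ) * (1 + z 0 ^ 2) / (1 + 2 * z 0 - z 0 ^ 2) ^ 2)
    A2 T ?_ ?_ (fun _ _ => zero_le_one) ?_ ?_ ?_ ?_ ?_ ?_ ?_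
  · rw [h2d]; ext z; simp [KZlog.mem_band]
  · rw [hTd]; ext z; simp [KZlog.mem_band]
  · -- semialgebraic
    have hq : ∀ z ∈ A2.domain, aeval z (1 + C (2:ℚ) * X 0 - X 0 ^ 2 : MvPolynomial (Fin 1) ℚ) ≠ 0 := by
      intro z hz
      have h := hD _ (hmem hz).1 (hmem hz).2
      simp only [map_sub, map_add, map_one, map_mul, MvPolynomial.aeval_C, map_pow, MvPolynomial.aeval_X,
        eq_ratCast, Rat.cast_ofNat]
      exact h.ne'
    refine (isSemialgebraicFunOn_aeval_div_aeval A2.isSemialgebraic_domain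
      (C ε * (X 0 ^ 2 + C (2:ℚ) * X 0 - 1)) (1 + C (2:ℚ) * X 0 - X 0 ^ 2) hq).congr fun z _ => ?_
    simp only [map_sub, map_add, map_one, map_mul, MvPolynomial.aeval_C, map_pow, MvPolynomial.aeval_X,
      eq_ratCast, Rat.cast_ofNat]
  · -- differentiable
    intro z hz
    have h := hD _ (hmem hz).1 (hmem hz).2
    have hnum : DifferentiableAt ℝ (fun w : Fin (0 + 1) → ℝ => (ε:ℝ) * (w 0 ^ 2 + 2 * w 0 - 1)) z := by
      fun_prop
    have hden' : DifferentiableAt ℝ (fun w : Fin (0 + 1) → ℝ => 1 + 2 * w 0 - w 0 ^ 2) z := by fun_prop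
    simp only [div_eq_mul_inv]
    exact hnum.fun_mul (hden'.fun_inv h.ne')
  · -- fibre derivative
    intro z hz
    have h := hD _ (hmem hz).1 (hmem hz).2
    simp only [Fin.last_zero, show ∀ t : ℝ, (Fin.snoc (Fin.init z) t : Fin 1 → ℝ) 0 = t from
      fun t => Fin.snoc_last (α := fun _ => ℝ) (x := t) (p := Fin.init z)]
    set t₀ : ℝ := z 0 with ht₀
    have h1 : HasDerivAt (fun t : ℝ => (ε:ℝ) * (t ^ 2 + 2 * t - 1)) ((ε:ℝ) * (2 * t₀ + 2 * 1)) t₀ := by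
      have := (((hasDerivAt_pow 2 t₀).add ((hasDerivAt_id' t₀).const_mul (2:ℝ))).sub_const (1:ℝ)).const_mul
        (ε:ℝ)
      refine this.congr_deriv ?_
      push_cast
      ring
    have h2 := (((hasDerivAt_id' t₀).const_mul (2:ℝ)).const_add (1:ℝ)).fun_sub (hasDerivAt_pow 2 t₀)
    have h3 := h1.fun_div h2 h.ne'
    refine h3.congr_deriv ?_
    have hD0 : (1 + 2 * t₀ - t₀ ^ 2) ≠ 0 := h.ne'
    rw [div_eq_div_iff (pow_ne_zero 2 hD0) (pow_ne_zero 2 hD0)]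
    push_cast
    ring
  · -- positivity of the fibre derivative
    intro z hz
    have h := hD _ (hmem hz).1 (hmem hz).2
    exact div_pos (by positivity) (pow_pos h 2)
  · intro y _
    simp only [show (Fin.snoc y (0:ℝ) : Fin 1 → ℝ) 0 = 0 from Fin.snoc_last (α := fun _ => ℝ) (x := 0) (p := y)]
    norm_num
  · intro y _
    simp only [show (Fin.snoc y (1:ℝ) : Fin 1 → ℝ) 0 = 1 from Fin.snoc_last (α := fun _ => ℝ) (x := 1) (p := y)]
    norm_num
  · -- integrand identity
    intro z hz
    have h := hD _ (hmem hz).1 (hmem hz).2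
    rw [h2i, hTi]
    simp only [show ∀ t : ℝ, (Fin.snoc (Fin.init z) t : Fin 1 → ℝ) 0 = t from
      fun t => Fin.snoc_last (α := fun _ => ℝ) (x := t) (p := Fin.init z)]
    set t : ℝ := z 0 with ht
    have hD0 : (1 + 2 * t - t ^ 2) ≠ 0 := h.ne'
    have ht2 : (1 + t ^ 2) ≠ 0 := by positivity
    have hε0 : (ε:ℝ) ≠ 0 := hε'.ne'
    have hD2 : (1 + 2 * t - t ^ 2) ^ 2 ≠ 0 := pow_ne_zero 2 hD0
    have hE : ((ε:ℝ) * (t ^ 2 + 2 * t - 1) / (1 + 2 * t - t ^ 2)) ^ 2 + (ε:ℝ) ^ 2 =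
        2 * (ε:ℝ) ^ 2 * (1 + t ^ 2) ^ 2 / (1 + 2 * t - t ^ 2) ^ 2 := by
      rw [div_pow, div_add' _ _ _ hD2, div_eq_div_iff hD2 hD2]
      ring
    have hbig : 2 * (ε:ℝ) ^ 2 * (1 + t ^ 2) ^ 2 * (1 + 2 * t - t ^ 2) ^ 2 ≠ 0 :=
      mul_ne_zero (mul_ne_zero (mul_ne_zero two_ne_zero (pow_ne_zero 2 hε0)) (pow_ne_zero 2 ht2)) hD2
    rw [hE, div_div_eq_mul_div, div_mul_div_comm, div_eq_div_iff ht2 hbig]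
    ring

/-- **The dilation** `v = ε t` of `[0,1]` onto `[0, ε]` carries `2 dt/(1+t²)` to `2ε dv/(ε²+v²)`: one
change-of-variables move. [Kontsevich–Zagier 2001, §1.2, rule 2)] -/
theorem of_sub_of_mem_relations_dilate (ε : ℚ) (hε : 0 < ε) (A2 V : IntegralRep 1)
    (h2d : A2.domain = {x | 0 ≤ x 0 ∧ x 0 ≤ 1}) (h2i : A2.integrand = fun x => 2 / (1 + x 0 ^ 2))
    (hVd : V.domain = {v | 0 ≤ v 0 ∧ v 0 ≤ (ε:ℝ)})
    (hVi : V.integrand = fun v => 2 * (ε:ℝ) / ((ε:ℝ) ^ 2 + v 0 ^ 2)) :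
    of A2 - of V ∈ relations := by
  have hε' : (0:ℝ) < ε := by exact_mod_cast hε
  refine of_sub_of_mem_relations_of_fibreMap (m := 0) (G := univ) (a := fun _ => 0) (b := fun _ => 1)
    (a' := fun _ => (0:ℝ)) (b' := fun _ => (ε:ℝ))
    (fun z => (ε:ℝ) * z 0) (fun _ => (ε:ℝ))
    A2 V ?_ ?_ (fun _ _ => zero_le_one) ?_ ?_ ?_ (fun _ _ => hε') ?_ ?_ ?_
  · rw [h2d]; ext z; simp [KZlog.mem_band]
  · rw [hVd]; ext z; simp [KZlog.mem_band]
  · refine (isSemialgebraicFunOn_aeval A2.isSemialgebraic_domain (C ε * X 0)).congr fun z _ => ?_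
    simp only [map_mul, MvPolynomial.aeval_C, MvPolynomial.aeval_X, eq_ratCast]
  · intro z _; fun_prop
  · intro z _
    simp only [Fin.last_zero, show ∀ t : ℝ, (Fin.snoc (Fin.init z) t : Fin 1 → ℝ) 0 = t from
      fun t => Fin.snoc_last (α := fun _ => ℝ) (x := t) (p := Fin.init z)]
    simpa using (hasDerivAt_id' (z 0)).const_mul (ε:ℝ)
  · intro y _
    simp only [show (Fin.snoc y (0:ℝ) : Fin 1 → ℝ) 0 = 0 from Fin.snoc_last (α := fun _ => ℝ) (x := 0) (p := y)]
    norm_num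
  · intro y _
    simp only [show (Fin.snoc y (1:ℝ) : Fin 1 → ℝ) 0 = 1 from Fin.snoc_last (α := fun _ => ℝ) (x := 1) (p := y)]
    norm_num
  · intro z _
    rw [h2i, hVi]
    simp only [show ∀ t : ℝ, (Fin.snoc (Fin.init z) t : Fin 1 → ℝ) 0 = t from
      fun t => Fin.snoc_last (α := fun _ => ℝ) (x := t) (p := Fin.init z)]
    set t : ℝ := z 0 with ht
    have ht2 : (1 + t ^ 2) ≠ 0 := by positivity
    have hε0 : (ε:ℝ) ≠ 0 := hε'.ne'
    field_simp

/-- **Half winding number, by the moves (relative form).** If `[π] − 4[A] ∈ relations` for the arctangent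
representation `A = [[0,1], dt/(1+t²)]`, then `[T] + [V] − [π] ∈ relations` for
`T = [[−ε, ε], ε du/(u²+ε²)]`, `V = [[0, ε], 2ε dv/(ε²+v²)]` (`ε ∈ ℚ_{>0}`). [this node; KZ §1.2 rules 1)–2)] -/
theorem halfWinding_of_arctanRep (A : IntegralRep 1) (hAd : A.domain = {x | 0 ≤ x 0 ∧ x 0 ≤ 1})
    (hAi : A.integrand = fun x => 1 / (1 + x 0 ^ 2)) (hπ : of piRep - 4 • of A ∈ relations)
    (ε : ℚ) (hε : 0 < ε) (T V : IntegralRep 1)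
    (hTd : T.domain = {u | -(ε:ℝ) ≤ u 0 ∧ u 0 ≤ (ε:ℝ)})
    (hTi : T.integrand = fun u => (ε:ℝ) / (u 0 ^ 2 + (ε:ℝ) ^ 2))
    (hVd : V.domain = {v | 0 ≤ v 0 ∧ v 0 ≤ (ε:ℝ)})
    (hVi : V.integrand = fun v => 2 * (ε:ℝ) / ((ε:ℝ) ^ 2 + v 0 ^ 2)) :
    of T + of V - of piRep ∈ relations := by
  have hIc : IsCompact A.domain := by
    rw [hAd, unitI_eq_cubeLit]; exact isCompact_univ_pi fun _ => isCompact_Icc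
  have hA2sa : IsSemialgebraicFunOn ℚ A.domain (fun x : Fin 1 → ℝ => 2 / (1 + x 0 ^ 2)) := by
    refine (isSemialgebraicFunOn_aeval_div_aeval A.isSemialgebraic_domain (C (2:ℚ)) (1 + X 0 ^ 2)
      fun z _ => ?_).congr fun z _ => ?_
    · simp only [map_add, map_one, map_pow, MvPolynomial.aeval_X]; positivity
    · simp only [map_add, map_one, map_pow, MvPolynomial.aeval_X, MvPolynomial.aeval_C, eq_ratCast,
        Rat.cast_ofNat]
  have hA2c : ContinuousOn (fun x : Fin 1 → ℝ => 2 / (1 + x 0 ^ 2)) A.domain :=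
    (continuous_const.div (by fun_prop) fun x => by positivity).continuousOn
  let A2 : IntegralRep 1 := contRep A.domain A.isSemialgebraic_domain hIc _ hA2sa hA2c
  -- doubling the integrand: 2[A] ≡ [A2]
  have h2 : of A + of A - of A2 ∈ relations := by
    have h : of A2 - of A - of A ∈ relations := by
      refine integrandAddRel_subset_relations ⟨1, A2, A, A, rfl, rfl, fun z _ => ?_, rfl⟩
      show (2:ℝ) / (1 + z 0 ^ 2) = (A.integrand + A.integrand) z
      rw [Pi.add_apply, hAi]
      ring
    have := relations.neg_mem h
    rwa [show -(of A2 - of A - of A) = of A + of A - of A2 by abel] at this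
  have hT : of A2 - of T ∈ relations := of_sub_of_mem_relations_halfTurn ε hε A2 T hAd rfl hTd hTi
  have hV : of A2 - of V ∈ relations := of_sub_of_mem_relations_dilate ε hε A2 V hAd rfl hVd hVi
  have e : of T + of V - of piRep =
      -(of piRep - 4 • of A) - ((of A + of A - of A2) + (of A + of A - of A2)) - (of A2 - of T) - (of A2 - of V) := by
    abel
  rw [e]
  exact sub_mem (sub_mem (sub_mem (relations.neg_mem hπ) (add_mem h2 h2)) hT) hV

/-- **Half winding number, by the moves (absolute form).** `[T] + [V] − [π] ∈ KZ.relations`, with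
`[π] ≡ 4[A]` discharged by the tree theorem `Theorems.soloInformed_piRep_sub_four_nsmul_arctanRep_mem_relations`.
[this node; `Theorems/SoloInformedPiDisc`] -/
theorem halfWinding (ε : ℚ) (hε : 0 < ε) (T V : IntegralRep 1)
    (hTd : T.domain = {u | -(ε:ℝ) ≤ u 0 ∧ u 0 ≤ (ε:ℝ)})
    (hTi : T.integrand = fun u => (ε:ℝ) / (u 0 ^ 2 + (ε:ℝ) ^ 2))
    (hVd : V.domain = {v | 0 ≤ v 0 ∧ v 0 ≤ (ε:ℝ)})
    (hVi : V.integrand = fun v => 2 * (ε:ℝ) / ((ε:ℝ) ^ 2 + v 0 ^ 2)) :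
    of T + of V - of piRep ∈ relations :=
  halfWinding_of_arctanRep Summit.KontsevichZagierPeriods.KontsevichZagierPeriods.Theorems.soloInformedArctanRep
    rfl rfl
    Summit.KontsevichZagierPeriods.KontsevichZagierPeriods.Theorems.soloInformed_piRep_sub_four_nsmul_arctanRep_mem_relations
    ε hε T V hTd hTi hVd hVi

end Summit.KontsevichZagierPeriods.RootDecompRationalCubeDichotomy.Rung27842
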